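import Literature.NumberTheory.EllipticCurves.BurungaleSkinner2023.RationalThreeTorsionEngineProofs
import HarnessLib

/-!
# Burungale–Skinner 2023, Example (E3), part I: the conductors `26`, `34`
# (curve-side hypotheses of Thm. 2.8 KERNEL-CHECKED; Thms. 2.9 / 3.2 / 3.5 modulo the named facts)

A. Burungale, C. Skinner, Proc. AMS Ser. B 10 (2023), p. 22, Example (E3): "The elliptic curves
26.a2, 34.a3, 35.a2, 38.a2, 44.a2, 50.a2, 106c2 also have rational `3`-torsion points and satisfy the
hypotheses of Theorem 2.8." The curve-side hypotheses of Thm. 2.8 (`p = 3`) are those of Thm. 2.9: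
`3 ∤ N`, a rational subgroup `Φ` of order `3` with `ϕ` even and unramified at `3`, and a prime
`ℓ₀ ∣ N` with `r_{ℓ₀} = 1` (`ℓ₀ ≡ −1 mod 3` if additive). They depend only on the isogeny class and a
rational point of order `3`; this file certifies them — via the engine
`RationalThreeTorsionEngineProofs` (decidable data: `3 ∤ Δ`, `ℓ₀ ∣ Δ`, `ℓ₀ ∤ c₄`, `r_{ℓ₀} = 1`, a
rational `T` with `2T = −T`) — for Cremona's first curve of the SEMISTABLE classes of conductor
`26` and `34` of (E3) (LMFDB class `26.a` = Cremona `26a`, `34.a` = `34a`; the LMFDB numbering of the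
curves inside a class differs from Cremona's, and Thm. 2.8's hypotheses are insensitive to the choice
of the curve carrying the rational `3`-torsion point):

* `26.a`: `26A1 = [1,0,1,−5,−8]`, `Δ = −2³·13³`, `N = 26`, `T = (4,4)`, `ℓ₀ = 2` (`r₂ = 1`);
* `34.a`: `34A1 = [1,0,0,−3,1]`, `Δ = 2⁶·17`, `N = 34`, `T = (2,1)`, `ℓ₀ = 2` (`r₁₇ = 3`: `2` is the
  only admissible `ℓ₀`).

For each curve `c`: `posProportion_twists_c` / `infinitelyMany_twists_c` (Thm. 2.9 modulo
`thm29_posProportion_twists_rankOne_nondegenerate`: a positive proportion of — so infinitely many —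
imaginary quadratic twists with `rank = ord_{s=1} L = 1`, `λ = 1` and NON-DEGENERATE `3`-adic height),
`infinitelyMany_twists_c_pPartBSD` (Thm. 3.2 modulo `thm32_…`),
`infinitelyMany_evenTwists_c_pPartBSD_rankZero` (Thm. 3.5 modulo `thm35_…`). Definitions with bodies
(the models and the points) + theorems; no new facts. Part II: `35`, `38`; part III: `44`, `50`,
`106`; (E2): `20.a3`.

References: [BurungaleSkinner2023] Example (E3) (p. 22), Thms. 2.8/2.9 (pp. 20–21), 3.2 (p. 25), 3.5
(p. 27); [CremonaAlgorithms1997] Table 1, `N = 26, 34`; [SilvermanAEC2009] VII.1 Rem. 1.1,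
VII.5 Prop. 5.1; [Silverman1994] IV.10.2.
-/

noncomputable section

open scoped Classical

open NumberField IsDedekindDomain IsDedekindDomain.HeightOneSpectrum WeierstrassCurve Polynomial
  Literature.NumberTheory.EllipticCurves Literature.NumberTheory.EllipticCurves.Rank1Residual
  Literature.NumberTheory.QuadraticFields.Quadratic

namespace Literature.NumberTheory.EllipticCurves.BurungaleSkinner2023

/-! ### `26.a`: Cremona `26A1 = [1, 0, 1, −5, −8]` -/

section C26

/-- Cremona `26A1 = [1,0,1,−5,−8]`, integer model (class `26.a` of (E3)).
[cite: CremonaAlgorithms1997, Table 1, N = 26, curve A1] -/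
abbrev M26a1 : WeierstrassCurve ℤ := ⟨1, 0, 1, -5, -8⟩

/-- `26A1 / ℚ`. [cite: CremonaAlgorithms1997, Table 1, N = 26, curve A1] -/
abbrev c26a1 : WeierstrassCurve ℚ := M26a1.baseChange ℚ

/-- `Δ(26A1) = −17576 = −2³·13³`. [cite: CremonaAlgorithms1997, Table 1, N = 26] -/
theorem M26a1_Δ : M26a1.Δ = -17576 := by decide

/-- `c₄(26A1) = 217 = 7·31`. [cite: CremonaAlgorithms1997, Table 1, N = 26] -/
theorem M26a1_c₄ : M26a1.c₄ = 217 := by decide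

/-- `26A1` is an elliptic curve. [cite: CremonaAlgorithms1997, Table 1, N = 26] -/
theorem isElliptic_c26a1 : c26a1.IsElliptic := by
  rw [WeierstrassCurve.isElliptic_iff, baseChange_int_Δ, M26a1_Δ]; norm_num

/-- `26A1` is a global minimal equation (`|Δ| < 3¹²`, `2¹² ∤ Δ`). [cite: SilvermanAEC2009, VII.1 Remark 1.1] -/
theorem isGloballyMinimal_c26a1 : c26a1.IsGloballyMinimal :=
  isGloballyMinimal_baseChange_int M26a1 (forall_not_pow_dvd_or_of_bound M26a1 (B := 3)
    (by rw [M26a1_Δ]; decide) (by rw [M26a1_Δ]; decide) (by rw [M26a1_Δ, M26a1_c₄]; decide))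

/-- **`N(26A1) = 26`** (semistable: `(Δ, c₄) = 1`, `N = rad Δ`). [cite: CremonaAlgorithms1997, Table 1, N = 26] -/
theorem conductorNorm_c26a1 : c26a1.conductorNorm ℤ = 26 := by
  haveI := isElliptic_c26a1
  refine conductorNorm_baseChange_int_of_isCoprime M26a1
    (by rw [M26a1_Δ, M26a1_c₄, Int.isCoprime_iff_gcd_eq_one]; decide) (k := 3) ?_ ?_ ?_
  · rw [Nat.squarefree_iff_nodup_primeFactorsList (by norm_num)]; simp
  · rw [M26a1_Δ]; decide
  · rw [M26a1_Δ]; decide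

/-- The coefficients of `26A1 / ℚ`. [cite: CremonaAlgorithms1997, Table 1, N = 26] -/
theorem c26a1_eq : c26a1 = ⟨1, 0, 1, -5, -8⟩ := by
  ext <;> simp [WeierstrassCurve.baseChange, WeierstrassCurve.map]

/-- The rational `3`-torsion point `T = (4, 4)` of `26A1` (`|E(ℚ)_{tors}| = 3`).
[cite: CremonaAlgorithms1997, Table 1, N = 26, curve A1 (|T| = 3)] -/
def T26a1 : c26a1.toAffine.Point :=
  Affine.Point.some 4 4 ((Affine.nonsingular_iff' _ _).mpr
    ⟨(Affine.equation_iff _ _).mpr (by rw [c26a1_eq]; norm_num), Or.inr (by rw [c26a1_eq]; norm_num)⟩)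

/-- `T + T = −T` on `26A1` (tangent slope `3` at `(4,4)`). [cite: CremonaAlgorithms1997, Table 1, N = 26] -/
theorem T26a1_add_self [DecidableEq ℚ] : T26a1 + T26a1 = -T26a1 := by
  have hy : (4 : ℚ) ≠ c26a1.toAffine.negY 4 4 := by rw [c26a1_eq]; norm_num [Affine.negY]
  unfold T26a1
  rw [Affine.Point.add_self_of_Y_ne hy, Affine.Point.neg_some]
  congr 1
  · rw [Affine.slope_of_Y_ne rfl hy, c26a1_eq]
    norm_num [Affine.addX, Affine.negY]
  · rw [Affine.slope_of_Y_ne rfl hy, c26a1_eq]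
    norm_num [Affine.addY, Affine.negAddY, Affine.addX, Affine.negY]

/-- `3·T̄ = O` in `E(ℚ̄)` for `26A1`. [cite: CremonaAlgorithms1997, Table 1, N = 26, curve A1 (|T| = 3)] -/
theorem three_nsmul_toGeomPoints_T26a1 : (3 : ℕ) • toGeomPoints c26a1 T26a1 = 0 := by
  have h3 : ∀ [DecidableEq ℚ], (3 : ℕ) • T26a1 = 0 := fun {_} => by
    rw [show (3 : ℕ) = 2 + 1 from rfl, add_nsmul, two_nsmul, one_nsmul, T26a1_add_self,
      neg_add_cancel]
  have h := map_nsmul (Affine.Point.map (W' := c26a1.toAffine) (S := ℚ)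
    (Algebra.ofId ℚ (AlgebraicClosure ℚ))) 3 T26a1
  rw [h3, map_zero] at h
  exact h.symm

/-- **Thm. 2.9 for `26.a` (`26A1`, `ℓ₀ = 2`)**, modulo `thm29_posProportion_twists_rankOne_nondegenerate`:
for a positive proportion of discriminants `d` of imaginary quadratic fields, `rank E^{(d)}(ℚ) =
ord_{s=1} L(E^{(d)}, s) = 1`, `λ = 1`, and the `3`-adic height on every global minimal model of
`E^{(d)}` is NON-DEGENERATE. [cite: BurungaleSkinner2023, Thm. 2.9 (p. 21) with Example (E3) (p. 22)] -/
theorem posProportion_twists_c26a1 (h : thm29_posProportion_twists_rankOne_nondegenerate) :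
    haveI := isElliptic_c26a1
    haveI := isGloballyMinimal_c26a1
    OddQuadraticCharPosProportion fun d ↦ TwistConclusion c26a1 3 d := by
  haveI := isElliptic_c26a1
  haveI := isGloballyMinimal_c26a1
  exact posProportion_twists_of_intModel M26a1 (ℓ₀ := 2) (by rw [M26a1_Δ]; decide)
    (by rw [M26a1_Δ]; decide) (by rw [M26a1_Δ]; decide) (by rw [M26a1_Δ]; decide)
    numPrimesAbove_three_two (fun _ => by decide) T26a1 (Affine.Point.some_ne_zero _)
    three_nsmul_toGeomPoints_T26a1 h

/-- **Infinitely many rank-one twists of `26A1` with non-degenerate `3`-adic height**, modulo Thm.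
2.9 by name. [cite: BurungaleSkinner2023, Thm. 2.9 (p. 21) with Example (E3) (p. 22)] -/
theorem infinitelyMany_twists_c26a1 (h : thm29_posProportion_twists_rankOne_nondegenerate) :
    haveI := isElliptic_c26a1
    haveI := isGloballyMinimal_c26a1
    {d : ℤ | IsOddQuadraticCharDiscr d ∧ TwistConclusion c26a1 3 d}.Infinite :=
  (posProportion_twists_c26a1 h).infinite

/-- **Thm. 3.2 for `26.a`**, modulo `thm32_posProportion_twists_pPartBSD`: infinitely many imaginary
quadratic twists with `ord_{s=1} L = 1` and the printed `3`-part of the rank-one BSD formula.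
[cite: BurungaleSkinner2023, Thm. 3.2 (p. 25) with Example (E3) (p. 22)] -/
theorem infinitelyMany_twists_c26a1_pPartBSD (h : thm32_posProportion_twists_pPartBSD) :
    haveI := isElliptic_c26a1
    haveI := isGloballyMinimal_c26a1
    {d : ℤ | IsOddQuadraticCharDiscr d ∧ ((c26a1.quadraticTwist (d : ℚ)).analyticRank = 1 ∧
      ∀ (W' : WeierstrassCurve ℚ) [W'.IsElliptic] [W'.IsGloballyMinimal] (C : VariableChange ℚ),
        C • c26a1.quadraticTwist (d : ℚ) = W' → PPartRankOnePrintShape W' 3)}.Infinite := by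
  haveI := isElliptic_c26a1
  haveI := isGloballyMinimal_c26a1
  exact infinitelyMany_twists_pPartBSD_of_intModel M26a1 (ℓ₀ := 2) (by rw [M26a1_Δ]; decide)
    (by rw [M26a1_Δ]; decide) (by rw [M26a1_Δ]; decide) (by rw [M26a1_Δ]; decide)
    numPrimesAbove_three_two (fun _ => by decide) T26a1 (Affine.Point.some_ne_zero _)
    three_nsmul_toGeomPoints_T26a1 h

/-- **Thm. 3.5 for `26.a`**, modulo `thm35_posProportion_evenTwists_pPartBSD_rankZero`: infinitely many
REAL quadratic twists with `L(E^{(d)}, 1) ≠ 0` and the printed `3`-part of the rank-zero BSD formula.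
[cite: BurungaleSkinner2023, Thm. 3.5 (p. 27) with Example (E3) (p. 22)] -/
theorem infinitelyMany_evenTwists_c26a1_pPartBSD_rankZero
    (h : thm35_posProportion_evenTwists_pPartBSD_rankZero) :
    haveI := isElliptic_c26a1
    haveI := isGloballyMinimal_c26a1
    {d : ℤ | IsEvenQuadraticCharDiscr d ∧ ((c26a1.quadraticTwist (d : ℚ)).entireLFunction 1 ≠ 0 ∧
      ∀ (W' : WeierstrassCurve ℚ) [W'.IsElliptic] [W'.IsGloballyMinimal] (C : VariableChange ℚ),
        C • c26a1.quadraticTwist (d : ℚ) = W' → PPartRankZeroPrintShape W' 3)}.Infinite := by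
  haveI := isElliptic_c26a1
  haveI := isGloballyMinimal_c26a1
  exact infinitelyMany_evenTwists_pPartBSD_rankZero_of_intModel M26a1 (ℓ₀ := 2)
    (by rw [M26a1_Δ]; decide) (by rw [M26a1_Δ]; decide) (by rw [M26a1_Δ]; decide)
    (by rw [M26a1_Δ]; decide) numPrimesAbove_three_two (fun _ => by decide) T26a1
    (Affine.Point.some_ne_zero _) three_nsmul_toGeomPoints_T26a1 h

end C26

/-! ### `34.a`: Cremona `34A1 = [1, 0, 0, −3, 1]` -/

section C34

/-- Cremona `34A1 = [1,0,0,−3,1]`, integer model (class `34.a` of (E3)).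
[cite: CremonaAlgorithms1997, Table 1, N = 34, curve A1] -/
abbrev M34a1 : WeierstrassCurve ℤ := ⟨1, 0, 0, -3, 1⟩

/-- `34A1 / ℚ`. [cite: CremonaAlgorithms1997, Table 1, N = 34, curve A1] -/
abbrev c34a1 : WeierstrassCurve ℚ := M34a1.baseChange ℚ

/-- `Δ(34A1) = 1088 = 2⁶·17`. [cite: CremonaAlgorithms1997, Table 1, N = 34] -/
theorem M34a1_Δ : M34a1.Δ = 1088 := by decide

/-- `c₄(34A1) = 145 = 5·29`. [cite: CremonaAlgorithms1997, Table 1, N = 34] -/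
theorem M34a1_c₄ : M34a1.c₄ = 145 := by decide

/-- `34A1` is an elliptic curve. [cite: CremonaAlgorithms1997, Table 1, N = 34] -/
theorem isElliptic_c34a1 : c34a1.IsElliptic := by
  rw [WeierstrassCurve.isElliptic_iff, baseChange_int_Δ, M34a1_Δ]; norm_num

/-- `34A1` is a global minimal equation. [cite: SilvermanAEC2009, VII.1 Remark 1.1] -/
theorem isGloballyMinimal_c34a1 : c34a1.IsGloballyMinimal :=
  isGloballyMinimal_baseChange_int M34a1 (forall_not_pow_dvd_or_of_bound M34a1 (B := 3)
    (by rw [M34a1_Δ]; decide) (by rw [M34a1_Δ]; decide) (by rw [M34a1_Δ, M34a1_c₄]; decide))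

/-- **`N(34A1) = 34`.** [cite: CremonaAlgorithms1997, Table 1, N = 34] -/
theorem conductorNorm_c34a1 : c34a1.conductorNorm ℤ = 34 := by
  haveI := isElliptic_c34a1
  refine conductorNorm_baseChange_int_of_isCoprime M34a1
    (by rw [M34a1_Δ, M34a1_c₄, Int.isCoprime_iff_gcd_eq_one]; decide) (k := 6) ?_ ?_ ?_
  · rw [Nat.squarefree_iff_nodup_primeFactorsList (by norm_num)]; simp
  · rw [M34a1_Δ]; decide
  · rw [M34a1_Δ]; decide

/-- The coefficients of `34A1 / ℚ`. [cite: CremonaAlgorithms1997, Table 1, N = 34] -/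
theorem c34a1_eq : c34a1 = ⟨1, 0, 0, -3, 1⟩ := by
  ext <;> simp [WeierstrassCurve.baseChange, WeierstrassCurve.map]

/-- The rational `3`-torsion point `T = (2, 1)` of `34A1` (`|E(ℚ)_{tors}| = 6`).
[cite: CremonaAlgorithms1997, Table 1, N = 34, curve A1 (|T| = 6)] -/
def T34a1 : c34a1.toAffine.Point :=
  Affine.Point.some 2 1 ((Affine.nonsingular_iff' _ _).mpr
    ⟨(Affine.equation_iff _ _).mpr (by rw [c34a1_eq]; norm_num), Or.inr (by rw [c34a1_eq]; norm_num)⟩)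

/-- `T + T = −T` on `34A1` (tangent slope `2` at `(2,1)`). [cite: CremonaAlgorithms1997, Table 1, N = 34] -/
theorem T34a1_add_self [DecidableEq ℚ] : T34a1 + T34a1 = -T34a1 := by
  have hy : (1 : ℚ) ≠ c34a1.toAffine.negY 2 1 := by rw [c34a1_eq]; norm_num [Affine.negY]
  unfold T34a1
  rw [Affine.Point.add_self_of_Y_ne hy, Affine.Point.neg_some]
  congr 1
  · rw [Affine.slope_of_Y_ne rfl hy, c34a1_eq]
    norm_num [Affine.addX, Affine.negY]
  · rw [Affine.slope_of_Y_ne rfl hy, c34a1_eq]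
    norm_num [Affine.addY, Affine.negAddY, Affine.addX, Affine.negY]

/-- `3·T̄ = O` in `E(ℚ̄)` for `34A1`. [cite: CremonaAlgorithms1997, Table 1, N = 34, curve A1 (|T| = 6)] -/
theorem three_nsmul_toGeomPoints_T34a1 : (3 : ℕ) • toGeomPoints c34a1 T34a1 = 0 := by
  have h3 : ∀ [DecidableEq ℚ], (3 : ℕ) • T34a1 = 0 := fun {_} => by
    rw [show (3 : ℕ) = 2 + 1 from rfl, add_nsmul, two_nsmul, one_nsmul, T34a1_add_self,
      neg_add_cancel]
  have h := map_nsmul (Affine.Point.map (W' := c34a1.toAffine) (S := ℚ)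
    (Algebra.ofId ℚ (AlgebraicClosure ℚ))) 3 T34a1
  rw [h3, map_zero] at h
  exact h.symm

/-- **Thm. 2.9 for `34.a` (`34A1`, `ℓ₀ = 2`)**, modulo `thm29_posProportion_twists_rankOne_nondegenerate`.
[cite: BurungaleSkinner2023, Thm. 2.9 (p. 21) with Example (E3) (p. 22)] -/
theorem posProportion_twists_c34a1 (h : thm29_posProportion_twists_rankOne_nondegenerate) :
    haveI := isElliptic_c34a1
    haveI := isGloballyMinimal_c34a1
    OddQuadraticCharPosProportion fun d ↦ TwistConclusion c34a1 3 d := by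
  haveI := isElliptic_c34a1
  haveI := isGloballyMinimal_c34a1
  exact posProportion_twists_of_intModel M34a1 (ℓ₀ := 2) (by rw [M34a1_Δ]; decide)
    (by rw [M34a1_Δ]; decide) (by rw [M34a1_Δ]; decide) (by rw [M34a1_Δ]; decide)
    numPrimesAbove_three_two (fun _ => by decide) T34a1 (Affine.Point.some_ne_zero _)
    three_nsmul_toGeomPoints_T34a1 h

/-- **Infinitely many rank-one twists of `34A1` with non-degenerate `3`-adic height**, modulo Thm.
2.9 by name. [cite: BurungaleSkinner2023, Thm. 2.9 (p. 21) with Example (E3) (p. 22)] -/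
theorem infinitelyMany_twists_c34a1 (h : thm29_posProportion_twists_rankOne_nondegenerate) :
    haveI := isElliptic_c34a1
    haveI := isGloballyMinimal_c34a1
    {d : ℤ | IsOddQuadraticCharDiscr d ∧ TwistConclusion c34a1 3 d}.Infinite :=
  (posProportion_twists_c34a1 h).infinite

/-- **Thm. 3.2 for `34.a`**, modulo `thm32_posProportion_twists_pPartBSD`.
[cite: BurungaleSkinner2023, Thm. 3.2 (p. 25) with Example (E3) (p. 22)] -/
theorem infinitelyMany_twists_c34a1_pPartBSD (h : thm32_posProportion_twists_pPartBSD) :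
    haveI := isElliptic_c34a1
    haveI := isGloballyMinimal_c34a1
    {d : ℤ | IsOddQuadraticCharDiscr d ∧ ((c34a1.quadraticTwist (d : ℚ)).analyticRank = 1 ∧
      ∀ (W' : WeierstrassCurve ℚ) [W'.IsElliptic] [W'.IsGloballyMinimal] (C : VariableChange ℚ),
        C • c34a1.quadraticTwist (d : ℚ) = W' → PPartRankOnePrintShape W' 3)}.Infinite := by
  haveI := isElliptic_c34a1
  haveI := isGloballyMinimal_c34a1
  exact infinitelyMany_twists_pPartBSD_of_intModel M34a1 (ℓ₀ := 2) (by rw [M34a1_Δ]; decide)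
    (by rw [M34a1_Δ]; decide) (by rw [M34a1_Δ]; decide) (by rw [M34a1_Δ]; decide)
    numPrimesAbove_three_two (fun _ => by decide) T34a1 (Affine.Point.some_ne_zero _)
    three_nsmul_toGeomPoints_T34a1 h

/-- **Thm. 3.5 for `34.a`**, modulo `thm35_posProportion_evenTwists_pPartBSD_rankZero`.
[cite: BurungaleSkinner2023, Thm. 3.5 (p. 27) with Example (E3) (p. 22)] -/
theorem infinitelyMany_evenTwists_c34a1_pPartBSD_rankZero
    (h : thm35_posProportion_evenTwists_pPartBSD_rankZero) :
    haveI := isElliptic_c34a1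
    haveI := isGloballyMinimal_c34a1
    {d : ℤ | IsEvenQuadraticCharDiscr d ∧ ((c34a1.quadraticTwist (d : ℚ)).entireLFunction 1 ≠ 0 ∧
      ∀ (W' : WeierstrassCurve ℚ) [W'.IsElliptic] [W'.IsGloballyMinimal] (C : VariableChange ℚ),
        C • c34a1.quadraticTwist (d : ℚ) = W' → PPartRankZeroPrintShape W' 3)}.Infinite := by
  haveI := isElliptic_c34a1
  haveI := isGloballyMinimal_c34a1
  exact infinitelyMany_evenTwists_pPartBSD_rankZero_of_intModel M34a1 (ℓ₀ := 2)
    (by rw [M34a1_Δ]; decide) (by rw [M34a1_Δ]; decide) (by rw [M34a1_Δ]; decide)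
    (by rw [M34a1_Δ]; decide) numPrimesAbove_three_two (fun _ => by decide) T34a1
    (Affine.Point.some_ne_zero _) three_nsmul_toGeomPoints_T34a1 h

end C34

end Literature.NumberTheory.EllipticCurves.BurungaleSkinner2023

end
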